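import Summits.AtomisticToContinuum.Crystallization.Theorems.ChartedZeroExcessLayeredLatticeLiouvilleTG

/-!
# Zero-excess layered lattice Liouville — piece (B4) `BondIsoTearFreeP`, stub T2: THE SHELL STRUCTURE OF CLEAN CONTACT GRAPHS
# (decomp-a2c, prover hand 1, generation 16; critic row 603 (2)(b), skeleton T1–T3 of lens-2 g35's NODE §4)

In a `(1/16, 9/10, 1)`-clean configuration `S` (`IsCleanP 1 (μS S)`: every site has a two-shell fcc/hcp chart at some scale `a ∈ [9/10, 1]` with
positional tolerance `a/16` covering every other site within `3a/2`), the bond relation of `IsBondIso` (`dist ≤ 28/25`) is EXACTLY first-shell adjacency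
and the second shell is two bonds away:

* §1 pattern facts (integer tables, `decide`): every second-shell vector of either two-shell pattern (`‖v‖ = √2`) has a first-shell pattern vector at
  distance exactly `1` (`exists_first_adj_of_norm_eq_sqrt_two`);
* §2 ★ `dist_le_of_dist_le_six_fifths` (THE GAP LEMMA): two sites at distance `≤ 6/5` are at distance `≤ 17/16` (`< 28/25`: a bond) — there are NO
  interatomic distances in `(17/16, (9/10)(√2 − 1/16)) ⊃ (1.0625, 1.2165)`; ★ `exists_two_bonds_of_dist_le` (T2): a site within `27/20 ≤ 3a/2` of `x` is
  joined to `x` by at most two bonds (first shell: one bond; second shell `f v`: through the chart point `f u` of the adjacent first-shell vector `u`,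
  `dist (f v) (f u) ≤ 9a/8 ≤ 9/8 ≤ 6/5`, which the gap lemma AT THE SITE `f u` turns into a bond).
These are the stubs T2 of `CleanBondPath 1` (`…TearFreeDoor`); the walk T1 (Euclid `≤ 4` ⇒ within `27/20` of a site `≤ 5` bonds away, planned with
first- AND second-shell moves — numerically 7 bonds reach `4.13`) is the one remaining stub.  All `[folklore]`; 0 sorry; no new definitions.
-/

noncomputable section

open Set Metric
open Summit.AtomisticToContinuum.Crystallization.Theorems.ChartedPlanarOrderRigidityDoor (E3 IsClean)
open Summit.AtomisticToContinuum.Crystallization.Theorems.ChartedPlanarOrderDensityDichotomy (μS)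
open Summit.AtomisticToContinuum.Crystallization.Theorems.ChartedPlanarOrderCleanScaleP (IsCleanP isCleanP_one_iff)
open Literature.Geometry.DiscreteGeometry (IsTwoShellGoodSet fccTwoShellPattern hcpTwoShellPattern norm_of_mem_fccTwoShellPattern
  norm_of_mem_hcpTwoShellPattern fccInt hcpInt fccSecondShellInt hcpSecondShellInt scaledPattern intVec sqNormInt norm_intVec intVec_sub
  sqNormInt_fccTwoShellInt sqNormInt_hcpTwoShellInt)

namespace Summit.AtomisticToContinuum.Crystallization.Theorems.ChartedZeroExcessLayeredLatticeLiouville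

/-! ## §XIII.1  Pattern facts: the second shell is adjacent to the first -/

/-- fcc integer model: every squared-norm-`4` vector has a squared-norm-`2` vector at squared distance `2`. [folklore] -/
theorem fccTwoShellInt_second_adj : ∀ v ∈ fccInt ∪ fccSecondShellInt, sqNormInt v = 4 →
    ∃ u ∈ fccInt ∪ fccSecondShellInt, sqNormInt u = 2 ∧ sqNormInt (v - u) = 2 := by decide

/-- hcp integer model: every squared-norm-`36` vector has a squared-norm-`18` vector at squared distance `18`. [folklore] -/
theorem hcpTwoShellInt_second_adj : ∀ v ∈ hcpInt ∪ hcpSecondShellInt, sqNormInt v = 36 →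
    ∃ u ∈ hcpInt ∪ hcpSecondShellInt, sqNormInt u = 18 ∧ sqNormInt (v - u) = 18 := by decide

/-- norm of a scaled integer vector: `‖(√N)⁻¹ • intVec w‖ = √(|w|²/N)`. [folklore] -/
theorem norm_scaled_intVec {N : ℕ} (hN : N ≠ 0) (w : Fin 3 → ℤ) :
    ‖(Real.sqrt N)⁻¹ • intVec w‖ = Real.sqrt ((sqNormInt w : ℝ) / N) := by
  have hpos : (0 : ℝ) < Real.sqrt N := Real.sqrt_pos.2 (by exact_mod_cast Nat.pos_of_ne_zero hN)
  rw [norm_smul, norm_inv, Real.norm_of_nonneg hpos.le, norm_intVec, Real.sqrt_div' _ (by positivity), inv_mul_eq_div]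

/-- distance of two scaled integer vectors: `√(|v − u|²/N)`. [folklore] -/
theorem dist_scaled_intVec {N : ℕ} (hN : N ≠ 0) (v u : Fin 3 → ℤ) :
    dist ((Real.sqrt N)⁻¹ • intVec v) ((Real.sqrt N)⁻¹ • intVec u) = Real.sqrt ((sqNormInt (v - u) : ℝ) / N) := by
  rw [dist_eq_norm, ← smul_sub, intVec_sub, norm_scaled_intVec hN]

/-- In a scaled pattern with the two squared norms `M₁` (first shell) and `M₂ = 2N ≠ M₁… ` — abstract form: if every vector of `T` has squared norm `M₁` or
`M₂`, `M₁ = N`, `M₂ = 2N`, and every `M₂`-vector has an `M₁`-vector at squared distance `N`, then every point of `scaledPattern T N` of norm `√2` has a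
point of norm `1` at distance `1`. [folklore] -/
theorem exists_first_adj_scaled {T : Finset (Fin 3 → ℤ)} {N : ℕ} (hN : N ≠ 0)
    (hnorms : ∀ v ∈ T, sqNormInt v = (N : ℤ) ∨ sqNormInt v = 2 * (N : ℤ))
    (hadj : ∀ v ∈ T, sqNormInt v = 2 * (N : ℤ) → ∃ u ∈ T, sqNormInt u = (N : ℤ) ∧ sqNormInt (v - u) = (N : ℤ))
    {x : E3} (hx : x ∈ scaledPattern T N) (h2 : ‖x‖ = Real.sqrt 2) : ∃ y ∈ scaledPattern T N, ‖y‖ = 1 ∧ dist x y = 1 := by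
  obtain ⟨v, hv, rfl⟩ := Finset.mem_image.1 hx
  have hNR : (0 : ℝ) < N := by exact_mod_cast Nat.pos_of_ne_zero hN
  have hv2 : sqNormInt v = 2 * (N : ℤ) := by
    rcases hnorms v hv with h | h
    · exfalso
      rw [norm_scaled_intVec hN, h] at h2
      have : Real.sqrt (((N : ℤ) : ℝ) / N) = 1 := by push_cast; rw [div_self hNR.ne', Real.sqrt_one]
      rw [this] at h2
      have h22 : (1 : ℝ) < Real.sqrt 2 := by
        rw [show (1 : ℝ) = Real.sqrt 1 from Real.sqrt_one.symm]; exact Real.sqrt_lt_sqrt (by norm_num) (by norm_num)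
      exact absurd h2 (ne_of_lt h22)
    · exact h
  obtain ⟨u, hu, hu1, hvu⟩ := hadj v hv hv2
  refine ⟨(Real.sqrt N)⁻¹ • intVec u, Finset.mem_image.2 ⟨u, hu, rfl⟩, ?_, ?_⟩
  · rw [norm_scaled_intVec hN, hu1]; push_cast; rw [div_self hNR.ne', Real.sqrt_one]
  · rw [dist_scaled_intVec hN, hvu]; push_cast; rw [div_self hNR.ne', Real.sqrt_one]

/-- ★ **every second-shell vector of either two-shell pattern has an adjacent first-shell vector** (`‖u‖ = 1`, `dist v u = 1`). [folklore] -/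
theorem exists_first_adj_of_norm_eq_sqrt_two {P : Finset E3} (hP : P = fccTwoShellPattern ∨ P = hcpTwoShellPattern) {v : E3} (hv : v ∈ P)
    (h2 : ‖v‖ = Real.sqrt 2) : ∃ u ∈ P, ‖u‖ = 1 ∧ dist v u = 1 := by
  rcases hP with rfl | rfl
  · exact exists_first_adj_scaled (T := fccInt ∪ fccSecondShellInt) (N := 2) two_ne_zero
      (fun w hw => by rcases sqNormInt_fccTwoShellInt w hw with h | h <;> [left; right] <;> simpa using h)
      (fun w hw h4 => by
        obtain ⟨u, hu, h2', hd⟩ := fccTwoShellInt_second_adj w hw (by simpa using h4)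
        exact ⟨u, hu, by simpa using h2', by simpa using hd⟩) hv h2
  · exact exists_first_adj_scaled (T := hcpInt ∪ hcpSecondShellInt) (N := 18) (by norm_num)
      (fun w hw => by rcases sqNormInt_hcpTwoShellInt w hw with h | h <;> [left; right] <;> simpa using h)
      (fun w hw h36 => by
        obtain ⟨u, hu, h18, hd⟩ := hcpTwoShellInt_second_adj w hw (by simpa using h36)
        exact ⟨u, hu, by simpa using h18, by simpa using hd⟩) hv h2

/-! ## §XIII.2  Clean configurations: the gap lemma and two bonds within `27/20` -/

/-- cleanliness at a site of `S`, with the atom set of `μS S` rewritten to `S`. [folklore] -/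
theorem twoShellGood_of_isCleanP_one {S : Set E3} (hS : IsCleanP 1 (μS S)) {x : E3} (hx : x ∈ S) :
    IsTwoShellGoodSet (1 / 16) (9 / 10) 1 S x := by
  have hatom : ∀ p : E3, (μS S) {p} ≠ 0 ↔ p ∈ S := fun p => Literature.Probability.Process.count_restrict_singleton_ne_zero_iff S p
  have hset : {p : E3 | (μS S) {p} ≠ 0} = S := Set.ext fun p => hatom p
  have h := hS x ((hatom x).2 hx)
  rw [hset] at h
  exact h

/-- `√2 > 1.39584` in the form used below: `(9/10)·(√2 − 1/16) > 6/5`. [folklore] -/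
theorem six_fifths_lt : (6 : ℝ) / 5 < 9 / 10 * (Real.sqrt 2 - 1 / 16) := by
  have h : (67 : ℝ) / 48 < Real.sqrt 2 := by
    rw [show (67 : ℝ) / 48 = Real.sqrt ((67 / 48) ^ 2) by rw [Real.sqrt_sq (by norm_num)]]
    exact Real.sqrt_lt_sqrt (by norm_num) (by norm_num)
  linarith

/-- ★ **SHELL DICHOTOMY** at a site `x` of a `(1/16, 9/10, 1)`-clean `S`: a site `y ≠ x` within `27/20` of `x` is EITHER first-shell (`dist ≤ 17/16`) OR
second-shell — then `dist > 6/5` and there is a site `w ∈ S` with `dist w x ≤ 17/16` and `dist y w ≤ 9/8`. [folklore] -/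
theorem shell_dichotomy {S : Set E3} (hS : IsCleanP 1 (μS S)) {x y : E3} (hx : x ∈ S) (hy : y ∈ S) (hne : y ≠ x) (hd : dist y x ≤ 27 / 20) :
    dist y x ≤ 17 / 16 ∨ (6 / 5 < dist y x ∧ ∃ w ∈ S, dist w x ≤ 17 / 16 ∧ dist y w ≤ 9 / 8) := by
  obtain ⟨a, ha₁, ha₂, A, P, f, hP, hf, -, hcov⟩ := twoShellGood_of_isCleanP_one hS hx
  have ha0 : 0 ≤ a := by linarith
  obtain ⟨v, hv, hfv⟩ := hcov y hy hne (by linarith)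
  have hclose : dist y (x + a • A v) ≤ 1 / 16 * a := by rw [← hfv]; exact (hf v hv).2
  have hcentre : dist (x + a • A v) x = a * ‖v‖ := by
    rw [dist_eq_norm, add_sub_cancel_left, norm_smul, Real.norm_of_nonneg ha0, A.norm_map]
  have hnorm : ‖v‖ = 1 ∨ ‖v‖ = Real.sqrt 2 := by
    rcases hP with rfl | rfl
    · exact norm_of_mem_fccTwoShellPattern hv
    · exact norm_of_mem_hcpTwoShellPattern hv
  rcases hnorm with h1 | h2
  · -- first shell
    left
    have := dist_triangle y (x + a • A v) x
    rw [hcentre, h1, mul_one] at this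
    linarith
  · -- second shell
    right
    have hfar : 6 / 5 < dist y x := by
      have t := dist_triangle (x + a • A v) y x
      rw [hcentre, h2, dist_comm (x + a • A v) y] at t
      have h65 := six_fifths_lt
      have hs0 : 0 ≤ Real.sqrt 2 - 1 / 16 := by linarith [Real.one_le_sqrt.2 (show (1 : ℝ) ≤ 2 by norm_num)]
      have : 9 / 10 * (Real.sqrt 2 - 1 / 16) ≤ a * (Real.sqrt 2 - 1 / 16) := mul_le_mul_of_nonneg_right ha₁ hs0
      nlinarith
    refine ⟨hfar, ?_⟩
    obtain ⟨u, hu, hu1, hvu⟩ := exists_first_adj_of_norm_eq_sqrt_two hP hv h2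
    refine ⟨f u, (hf u hu).1, ?_, ?_⟩
    · have hcu : dist (x + a • A u) x = a := by
        rw [dist_eq_norm, add_sub_cancel_left, norm_smul, Real.norm_of_nonneg ha0, A.norm_map, hu1, mul_one]
      have := dist_triangle (f u) (x + a • A u) x
      rw [hcu] at this
      linarith [(hf u hu).2]
    · have hmid : dist (x + a • A v) (x + a • A u) = a := by
        rw [dist_eq_norm, add_sub_add_left_eq_sub, ← smul_sub, norm_smul, Real.norm_of_nonneg ha0, ← map_sub, A.norm_map, ← dist_eq_norm, hvu,
          mul_one]
      have t1 := dist_triangle y (x + a • A v) (x + a • A u)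
      have t2 := dist_triangle y (x + a • A u) (f u)
      have h3 : dist (x + a • A u) (f u) ≤ 1 / 16 * a := by rw [dist_comm]; exact (hf u hu).2
      linarith

/-- ★★ **THE GAP LEMMA**: in a `(1/16, 9/10, 1)`-clean configuration, two sites at distance `≤ 6/5` are at distance `≤ 17/16` — in particular bonded
(`17/16 < 28/25`).  No interatomic distance lies in `(17/16, (9/10)(√2 − 1/16))`. [folklore] -/
theorem dist_le_of_dist_le_six_fifths {S : Set E3} (hS : IsCleanP 1 (μS S)) {x y : E3} (hx : x ∈ S) (hy : y ∈ S) (hd : dist y x ≤ 6 / 5) :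
    dist y x ≤ 17 / 16 := by
  by_cases hne : y = x
  · subst hne; rw [dist_self]; norm_num
  rcases shell_dichotomy hS hx hy hne (by linarith) with h | ⟨h, -⟩
  · exact h
  · linarith

/-- the bond relation of `IsBondIso` restricted to a clean configuration is first-shell adjacency: `dist ≤ 28/25 → dist ≤ 17/16`. [folklore] -/
theorem dist_le_of_bond {S : Set E3} (hS : IsCleanP 1 (μS S)) {x y : E3} (hx : x ∈ S) (hy : y ∈ S) (hd : dist y x ≤ 28 / 25) :
    dist y x ≤ 17 / 16 :=
  dist_le_of_dist_le_six_fifths hS hx hy (by linarith)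

/-- ★★ **T2 — TWO BONDS WITHIN `27/20`**: a site `y` within `27/20` of a site `x` of a `(1/16, 9/10, 1)`-clean `S` is joined to `x` through some `w ∈ S` with
`dist w x ≤ 28/25` and `dist y w ≤ 28/25` (`w = y` in the first shell). [folklore] -/
theorem exists_two_bonds_of_dist_le {S : Set E3} (hS : IsCleanP 1 (μS S)) {x y : E3} (hx : x ∈ S) (hy : y ∈ S) (hd : dist y x ≤ 27 / 20) :
    ∃ w ∈ S, dist w x ≤ 28 / 25 ∧ dist y w ≤ 28 / 25 := by
  by_cases hne : y = x
  · subst hne; exact ⟨y, hy, by rw [dist_self]; norm_num, by rw [dist_self]; norm_num⟩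
  rcases shell_dichotomy hS hx hy hne hd with h | ⟨-, w, hw, hwx, hyw⟩
  · exact ⟨y, hy, by linarith, by rw [dist_self]; norm_num⟩
  · refine ⟨w, hw, by linarith, ?_⟩
    have := dist_le_of_dist_le_six_fifths hS hw hy (by linarith)
    linarith

/-- the same for `IsClean` (`= IsCleanP 1`). [folklore] -/
theorem exists_two_bonds_of_dist_le' {S : Set E3} (hS : IsClean (μS S)) {x y : E3} (hx : x ∈ S) (hy : y ∈ S) (hd : dist y x ≤ 27 / 20) :
    ∃ w ∈ S, dist w x ≤ 28 / 25 ∧ dist y w ≤ 28 / 25 :=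
  exists_two_bonds_of_dist_le ((isCleanP_one_iff (μS S)).2 hS) hx hy hd

end Summit.AtomisticToContinuum.Crystallization.Theorems.ChartedZeroExcessLayeredLatticeLiouville

end
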